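import Summits.QuantumFields.YangMills.Theorems.BalabanUVNodesN10AtRecord13B13
import Literature.MathematicalPhysics.QuantumFieldTheory.Balaban1983to89.Node00.Record13LiveSelector

/-!
# BalabanUVNodes ∕ N10 ON THE STAGE-13 WITNESS LINE OF RECORD `θ₁₃ := Node00.theta13LiveOfRecord F N` (node00-def-K0a FILE 8 `Node00/Record13LiveSelector`) —
# the letter rows N10 reads are THEOREMS there (`κ = 2·10⁴`, `L = F.L ≥ 13` so `8 ≤ L` and `12 ≤ L·(n+1)`, `γ = ½` (rfl), admissibility), and N10's conjunct of K1‴'s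
# `NodesAtSomeRecord13` AT THE WITNESS ⟸ `Provisos₁₃` at it + THE LEAF at the [B13] layer (Track A, DAG node N10 [B13]; strategy s2; seat `pub-ymgap-dag-n10-d` g5;
# the witness-line instance of `…N10AtRecord13B13` p491722 §2, as dag-n08-c's `…N08AtRecord13` §3 is for N08)

HONEST FRAMING.  Count-neutral kernel bookkeeping over LANDED modules: node00-def-K0a's `Node00/Record13LiveSelector` (p488983: the WITNESS OF RECORD `theta13LiveOfRecord F N
:= theta13LiveOfFamily F N eps0OfRecord₁₃ …` over the dictionary OF THE FAMILY `stage3OfFamily F` — `L := F.L`, LOCATED-N10-ELL's cure —, with `admissible_theta13LiveOfRecord`,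
`ztUnity_theta13LiveOfRecord`, `slotsNondegenerate₁₃_theta13LiveOfRecord (h : Provisos₁₃)`, `theta13LiveOfFamily_κ : κ = 20000`, `eight_le_L_theta13LiveOfFamily`,
`theta13LiveOfFamily_ℓ₆_succ : ℓ₆ + 1 = F.L`, `theta13LiveOfFamily_γ : γ = ½`) and this seat's `…N10AtRecord13B13` (p491722: the K1‴-facing ∃-faces over the [B13] pin at
Stage 13).  §1 THE LETTER ROWS AT THE WITNESS: `2·10⁴ ≤ κ` (N10's eight rate rows then follow by `…N10AtRecord12B13FamilyWitness` §3 ∕ `…RateDischarged`), `8 ≤ ℓ₆ + 1`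
(the level-T binder `hL8` — FALSE at the Stage-12 witnesses, p486907 §2; TRUE here), `12 ≤ (ℓ₆ + 1)·(n + 1)` for EVERY torus index `n` (the binder `hN12`).  §2 N10's
CONJUNCT OF `stub_nodes13`'s `NodesAtSomeRecord13` AT THE WITNESS: from `Provisos₁₃` at `θ₁₃` (K0‴'s residual hypothesis — rows (H-U) ∕ P6 ∕ P11, other seats') and
THE LEAF at a per-run [B13] layer (resp. the family leaf of record at selected box members), the world bound at the C-binding of the [B13]-pinned Stage-13 view of
`θ₁₃` is a ₁₃C record OF THE WITNESS's DATUM, window `½`, block size `F.L`, the rev-16 guard and admissibility HOLD AT `θ₁₃` (K0a's theorems), and `Dag.B13_main` at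
every run.  What it does NOT supply: the leaf (NODE A's content + the located Lemma 1–2 inputs about the HIDDEN layer — hypotheses), the other twelve nodes at the same
world, `Provisos₁₃` itself.  §3 HONESTY: at the witness too the ∃-currency is junk-dischargeable through def-B13's zero tower (p491722 §3 instantiated) — so §2 is
content-free until `lam13` is the term tower OF RECORD.  Nothing of Bałaban's is asserted; N10 is NOT discharged; K0‴ ∕ K1‴ NOT asserted; no node count moves;
one finite four-torus programme at fixed ε per run; nothing continuum ∕ ℝ⁴ ∕ OS ∕ mass-gap ∕ Clay.  0 `sorry`, 0 `def`, standard axioms.  Filed `--supports` K1‴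
«StabilityBAtRecordR13e» (stmt-QuantumFields-19910) of route «BalabanUVNodes».

WHAT THIS FILE PROVES.  §1 `kp_n10_theta13LiveOfRecord`, `eight_le_L_theta13LiveOfRecord`, `L_theta13LiveOfRecord`, `twelve_le_L_mul_theta13LiveOfRecord`,
(the window letter `γ = ½` is dag-n08-c's `N08AtRecord13.theta13LiveOfRecord_γ`, `rfl` — used inline); §2 `exists_record₁₃C_guarded_b13_main_at_theta13LiveOfRecord_of_leafOfRecord`, `…_of_famLeafOfRecord`;
§3 `exists_record₁₃C_guarded_b13_main_at_theta13LiveOfRecord_of_zeroTower`.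
-/

namespace Summit.QuantumFields.YangMills.BalabanUVNodes.N10AtRecord13Witness

open Literature.MathematicalPhysics.QuantumFieldTheory.Balaban1983to89
open Literature.MathematicalPhysics.QuantumFieldTheory.Balaban1983to89.T4Continuum
open Literature.MathematicalPhysics.QuantumFieldTheory.Balaban1983to89.DagBinding
open Literature.MathematicalPhysics.QuantumFieldTheory.Balaban1983to89.Node00
open Summit.QuantumFields.YangMills.BalabanUVNodes.N10AtRecord13B13
  (exists_record₁₃C_pinB13World_b13_main_of_leafOfRecord exists_record₁₃C_pinB13World_b13_main_of_famLeafOfRecord exists_record₁₃C_world_b13_main_of_zeroTower)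
open scoped Matrix.Norms.L2Operator

/-! ## §1. The letter rows N10 reads, at the witness of record -/

section Letters

variable (F : T4Family) (N : ℕ) [NeZero N]

/-- **N10's re-pinned rate at the witness of record**: `2·10⁴ ≤ θ₁₃.s2.lf.κ` (K0a's `kp_n10_theta13LiveOfFamily`). [cite: Balaban1987RG1, (1.18) p.263; Balaban1988RG2Cluster, (1.26) p.8 (bookkeeping numeral)] -/
theorem kp_n10_theta13LiveOfRecord : (2 * 10 ^ 4 : ℝ) ≤ (theta13LiveOfRecord F N).s2.lf.κ :=
  kp_n10_theta13LiveOfFamily F N _ _ _ _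

/-- **The level-T binder `hL8` HOLDS at the witness of record**: `8 ≤ θ₁₃.ℓ₆ + 1` (the dictionary OF THE FAMILY: `L = F.L`, print's odd `L > 11`; K0a's
`eight_le_L_theta13LiveOfFamily` — the cure of LOCATED-N10-ELL, p486907 §2). [cite: Balaban1987RG1, p.251 («L is an odd, positive integer > 11»); Balaban1988RG2Cluster, (2.36) p.19] -/
theorem eight_le_L_theta13LiveOfRecord : 8 ≤ (theta13LiveOfRecord F N).ℓ₆ + 1 :=
  eight_le_L_theta13LiveOfFamily F N _ _ _ _

/-- The witness's block size IS the family's: `θ₁₃.ℓ₆ + 1 = F.L`. [cite: Balaban1987RG1, p.251 (bookkeeping)] -/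
theorem L_theta13LiveOfRecord : (theta13LiveOfRecord F N).ℓ₆ + 1 = F.L :=
  theta13LiveOfFamily_ℓ₆_succ F N _ _ _ _

/-- **The torus-size binder `hN12` HOLDS at the witness of record for EVERY torus index `n`**: `12 ≤ (θ₁₃.ℓ₆ + 1)·(n + 1)` (`F.L ≥ 13`). [cite: Balaban1987RG1, (3.54) p.285, p.251 (bookkeeping numeral)] -/
theorem twelve_le_L_mul_theta13LiveOfRecord (n : ℕ) : 12 ≤ ((theta13LiveOfRecord F N).ℓ₆ + 1) * (n + 1) := by
  rw [L_theta13LiveOfRecord]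
  have h11 := F.hL11
  calc 12 ≤ F.L := by omega
    _ = F.L * 1 := (Nat.mul_one _).symm
    _ ≤ F.L * (n + 1) := Nat.mul_le_mul_left _ (Nat.succ_le_succ (Nat.zero_le n))

end Letters

/-! ## §2. N10's conjunct of K1‴'s `NodesAtSomeRecord13` AT THE WITNESS OF RECORD, modulo `Provisos₁₃` at it and the leaf -/

section AtWitness

variable (F : T4Family) (N : ℕ) [NeZero N]

/-- **N10's CONJUNCT OF `NodesAtSomeRecord13` AT THE WITNESS OF RECORD, FROM THE LEAF.**  Given `Provisos₁₃` at `θ₁₃ := theta13LiveOfRecord F N` (K0‴'s residual hypothesis)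
and a per-run [B13] layer `lam13` carrying the leaf at the group of record at every run, there is a world — the C-binding of the [B13]-pinned Stage-13 view of `θ₁₃`,
window `½`, block size `F.L` — that is a ₁₃C record OF THE WITNESS's DATUM with the rev-16 guard `ZtUnity ∧ SlotsNondegenerate₁₃` and admissibility holding AT `θ₁₃`
(K0a's theorems) and `Dag.B13_main` at every run.  The shape is `K1Skeleton13.NodesAtSomeRecord13`'s with `Nodes` replaced by its N10 conjunct; the other twelve
conjuncts at the SAME world are the other seats'.  Count-neutral; nothing of Bałaban's asserted.
[cite: Balaban1988RG2Cluster, Lemmas 1–3 pp.9, 11, 20; Balaban1989LargeFieldII, Thm 1 + (0.1) pp.355–356; Balaban1988Convergent, (3.16)–(3.22) pp.268–269 (the guard)] -/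
theorem exists_record₁₃C_guarded_b13_main_at_theta13LiveOfRecord_of_leafOfRecord (hP : (theta13LiveOfRecord F N).Provisos₁₃ F N)
    (lam13 : B12.RunParams → ResidB13 (theta13LiveOfRecord F N).toStage3Params) (hleaf : ∀ P, B13LeafOfRecord (theta13LiveOfRecord F N).toStage3Params (lam13 P)) :
    ∃ w : WorldP, ((theta13LiveOfRecord F N).ZtUnity F N ∧ (theta13LiveOfRecord F N).SlotsNondegenerate₁₃ F N) ∧ (theta13LiveOfRecord F N).Admissible F N ∧
      IsRecordOfRecord₁₃C F N (datumOfRecord₁₃ F N (theta13LiveOfRecord F N) hP) w ∧ w.γ = 1 / 2 ∧ w.L = (F.L : ℝ) ∧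
      (∀ P, w.up P = upOfRecord₅C F N (((theta13LiveOfRecord F N).pinB13 F N lam13).toStage5₁₃ F N) P) ∧ ∀ P : B12.RunParams, Dag.B13_main (leavesP w P) := by
  obtain ⟨w, hR, hγ, hL, hup, hN⟩ := exists_record₁₃C_pinB13World_b13_main_of_leafOfRecord F N (theta13LiveOfRecord F N) hP
    (admissible_theta13LiveOfRecord F N) lam13 (γw := 1 / 2) ⟨one_half_pos, ((rfl : (theta13LiveOfRecord F N).γ = 1 / 2)).symm.le⟩ hleaf
  refine ⟨w, ⟨ztUnity_theta13LiveOfRecord F N, slotsNondegenerate₁₃_theta13LiveOfRecord F N hP⟩, admissible_theta13LiveOfRecord F N, hR, hγ, ?_, hup, hN⟩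
  rw [hL, ← (theta13LiveOfRecord F N).hℓ₆, L_theta13LiveOfRecord]

/-- **THE SAME FROM THE FAMILY LEAF OF RECORD** at selected box members `(κ P, ν P)` with the letters of record (the family currency read at `θ₁₃.toStage12Params`).
[cite: Balaban1988RG2Cluster, Lemmas 1–3 pp.9, 11, 20; Balaban1987RG1, Thm 3 p.264; Balaban1989LargeFieldII, Thm 1 + (0.1) pp.355–356] -/
theorem exists_record₁₃C_guarded_b13_main_at_theta13LiveOfRecord_of_famLeafOfRecord (hP : (theta13LiveOfRecord F N).Provisos₁₃ F N) (c : B13.Consts)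
    (lamF : ResidB13Fam₁₂ F N (theta13LiveOfRecord F N).toStage12Params)
    (hleaf : ∀ P, B13FamLeafOfRecord₁₂ F N (theta13LiveOfRecord F N).toStage12Params c lamF P) (κ : B12.RunParams → ℕ)
    (ν : (P : B12.RunParams) → Fin (κ P + 1) → ℝ) (hν : ∀ P, ν P ∈ FlowStep.Box (theta13LiveOfRecord F N).γ (κ P))
    (hc : ∀ P, (lamF P (κ P) (ν P)).c = c13OfRecord₁₂ F N (theta13LiveOfRecord F N).toStage12Params c) :
    ∃ w : WorldP, ((theta13LiveOfRecord F N).ZtUnity F N ∧ (theta13LiveOfRecord F N).SlotsNondegenerate₁₃ F N) ∧ (theta13LiveOfRecord F N).Admissible F N ∧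
      IsRecordOfRecord₁₃C F N (datumOfRecord₁₃ F N (theta13LiveOfRecord F N) hP) w ∧ w.γ = 1 / 2 ∧ w.L = (F.L : ℝ) ∧
      (∀ P, w.up P = upOfRecord₅C F N (((theta13LiveOfRecord F N).pinB13 F N fun P => lamF P (κ P) (ν P)).toStage5₁₃ F N) P) ∧
        ∀ P : B12.RunParams, Dag.B13_main (leavesP w P) :=
  exists_record₁₃C_guarded_b13_main_at_theta13LiveOfRecord_of_leafOfRecord F N hP (fun P => lamF P (κ P) (ν P))
    fun P => b13LeafOfRecord_member₁₂ (hleaf P) (hν P) (hc P)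

end AtWitness

/-! ## §3. HONESTY at the witness: the ∃-currency is still junk-dischargeable through def-B13's zero tower -/

section Honesty

variable (F : T4Family) (N : ℕ) [NeZero N]

/-- **AT THE WITNESS OF RECORD TOO, N10's ∃-conjunct is junk-dischargeable** (`…N10AtRecord13B13.exists_record₁₃C_world_b13_main_of_zeroTower` at `θ₁₃`): from `Provisos₁₃`
at `θ₁₃` ALONE there is a guarded, admissible ₁₃C record of the witness's datum with `Dag.B13_main` at every run — so §2 carries content only when `lam13` is the term
tower OF RECORD and the leaf comes from located inputs that are theorems about it.  A reading for the rev-16 planner and the referees, not against print.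
[cite: Balaban1988RG2Cluster, (1.33) p.9, (2.9)–(2.14) pp.14–15, Lemmas 1–3 pp.9, 11, 20 (the terms are the expansion's, in print)] -/
theorem exists_record₁₃C_guarded_b13_main_at_theta13LiveOfRecord_of_zeroTower (hP : (theta13LiveOfRecord F N).Provisos₁₃ F N) :
    ∃ w : WorldP, ((theta13LiveOfRecord F N).ZtUnity F N ∧ (theta13LiveOfRecord F N).SlotsNondegenerate₁₃ F N) ∧ (theta13LiveOfRecord F N).Admissible F N ∧
      IsRecordOfRecord₁₃C F N (datumOfRecord₁₃ F N (theta13LiveOfRecord F N) hP) w ∧ w.γ = 1 / 2 ∧ ∀ P : B12.RunParams, Dag.B13_main (leavesP w P) := by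
  obtain ⟨w, hR, hγ, -, hN⟩ := exists_record₁₃C_world_b13_main_of_zeroTower F N (theta13LiveOfRecord F N) hP (admissible_theta13LiveOfRecord F N)
    (γw := 1 / 2) ⟨one_half_pos, ((rfl : (theta13LiveOfRecord F N).γ = 1 / 2)).symm.le⟩
  exact ⟨w, ⟨ztUnity_theta13LiveOfRecord F N, slotsNondegenerate₁₃_theta13LiveOfRecord F N hP⟩, admissible_theta13LiveOfRecord F N, hR, hγ, hN⟩

end Honesty

end Summit.QuantumFields.YangMills.BalabanUVNodes.N10AtRecord13Witness
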